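import Summits.ValiantsHypothesis.ValiantsHypothesis.Theorems.FeketeSOSFeketeSOSHardPaleyRIPTensorPattern

/-!
# Route FeketeSOS — crux `FeketeSOSHard` (stmt-ValiantsHypothesis-3996), line `paley-rip` (skeleton v3):
# separable (tensor) pairs on `S = D + H` are TAME — `stub_tameOperator` at rank 2 with exponent 1 there

Companion of `…PaleyRIPTensorPattern.lean`.  For a separable pair `a = α·U`, `b = β·V` (`α, β` on a Sidon set `D`,
`U, V` on `H`, direct sumset `S = D + H`, no wrap-around) the cyclic pattern is `F = (αβ)·(UV)` and the cheap
representation is obtained by SPREADING ALONG `H` AND KEEPING THE PRODUCT ALONG `D`: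

  `F = Σ_{f ∈ H+H} (UV)_f · (X^{h_f} γ_f α) · (X^{h'_f} γ_f β)`,  `h_f + h'_f = f`,  `γ_f² = (UV)_f`,

each product being two balanced squares (P1, `exists_squares_of_mul`) supported in `S` of mass
`|(UV)_f| · ‖α‖‖β‖ ≤ √2 · #D · M` (`tensor_energy_bound`).  Total: mass `≤ 2 · #(H+H) · #D · M`
(`tameOperator_tensor`) — exponent 1 in `#S = #D·#H` whenever `H` has bounded doubling (intervals, APs), although
such pairs can be arbitrarily WILD (`‖a‖‖b‖/‖F‖_∞` unbounded: near-zero-divisors `(U, V)` on the structured factor)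
and their patterns ℓ¹-spread over `≈ #D² · #(H+H)` sums, defeating the certificates P1, P2, P3 of the census
simultaneously (census §4 O6, §5).  This is the positive content of "every hand-built wild pair is separable, hence
tame"; the open case of `stub_tameOperator` at rank 2 is NON-separable pairs on such supports (Slepian rows, §5).

Honest framing: `stub_tameOperator`, the engine and the crux stay OPEN; `VP ≠ VNP` untouched.
-/

set_option linter.dupNamespace false

namespace Summit.ValiantsHypothesis.ValiantsHypothesis.Theorems.FeketeSOSHardPaleyRIP

open Polynomial Finset
open scoped BigOperators

noncomputable section

section TensorTame

variable (p : ℕ) [Fact p.Prime]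

omit [Fact p.Prime] in
/-- `supp (C γ · X^h · α) ⊆ D + H` (as the image of `D × H` under `+`) when `supp α ⊆ D`, `h ∈ H`. [folklore] -/
theorem support_shift_subset {D H : Finset ℕ} (γ : ℂ) {h : ℕ} (hh : h ∈ H) (α : ℂ[X]) (hα : α.support ⊆ D) :
    (C γ * X ^ h * α).support ⊆ (D ×ˢ H).image (fun q : ℕ × ℕ => q.1 + q.2) := by
  refine support_mul_subset_of fun i hi j hj => ?_
  have hi' : i = h := Finset.mem_singleton.1 (support_C_mul_X_pow_subset h γ hi)
  subst hi'
  exact Finset.mem_image.2 ⟨(j, i), Finset.mem_product.2 ⟨hα hj, hh⟩, add_comm _ _⟩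

omit [Fact p.Prime] in
/-- Coefficient mass of a shifted weighted factor: `Σ_{s ∈ D+H} |(γ X^h φ)_s|² = |γ|² Σ_{d∈D} |φ_d|²`
(`supp φ ⊆ D`, `h ∈ H`). [folklore] -/
theorem sum_normSq_shift {D H : Finset ℕ} (γ : ℂ) {h : ℕ} (hh : h ∈ H) (φ : ℂ[X]) (hφ : φ.support ⊆ D) :
    ∑ s ∈ (D ×ˢ H).image (fun q : ℕ × ℕ => q.1 + q.2), ‖(C γ * X ^ h * φ).coeff s‖ ^ 2 =
      ‖γ‖ ^ 2 * ∑ d ∈ D, ‖φ.coeff d‖ ^ 2 := by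
  classical
  have hcoef : ∀ s, (C γ * X ^ h * φ).coeff s = γ * (if h ≤ s then φ.coeff (s - h) else 0) := by
    intro s; rw [mul_assoc, coeff_C_mul, coeff_X_pow_mul']
  have hsub : D.image (fun d => d + h) ⊆ (D ×ˢ H).image (fun q : ℕ × ℕ => q.1 + q.2) := by
    intro s hs
    obtain ⟨d, hd, rfl⟩ := Finset.mem_image.1 hs
    exact Finset.mem_image.2 ⟨(d, h), Finset.mem_product.2 ⟨hd, hh⟩, rfl⟩
  rw [← Finset.sum_subset hsub]
  · rw [Finset.sum_image (fun d _ d' _ hdd => by simpa using hdd), Finset.mul_sum]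
    refine Finset.sum_congr rfl fun d _ => ?_
    rw [hcoef, if_pos (Nat.le_add_left h d), Nat.add_sub_cancel, norm_mul, mul_pow]
  · intro s _ hns
    rw [hcoef]
    split_ifs with hle
    · have hz : φ.coeff (s - h) = 0 := by
        by_contra hne
        apply hns
        exact Finset.mem_image.2 ⟨s - h, hφ (mem_support_iff.2 hne), Nat.sub_add_cancel hle⟩
      rw [hz, mul_zero, norm_zero]; ring
    · rw [mul_zero, norm_zero]; ring

/-- **Separable pairs are tame.**  Let `D` be Sidon, `S = D + H` a direct sumset without wrap-around
(`hDirect`, `hNoWrap`), `α, β` supported in `D`, `U, V` supported in `H`, and let `F` be the cyclic pattern of the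
product `(αU)·(βV)` (`deg F < p`, `X^p − 1 ∣ (αU)(βV) − F`) with `|F_n| ≤ M`.  Then there are weighted squares
supported in `S` with the same cyclic pattern and total mass `≤ 2 · #(H+H) · #D · M`. [folklore] -/
theorem tameOperator_tensor (D H : Finset ℕ) (α β U V F : ℂ[X])
    (hα : α.support ⊆ D) (hβ : β.support ⊆ D) (hU : U.support ⊆ H) (hV : V.support ⊆ H)
    (hSidon : ∀ d₁ ∈ D, ∀ d₂ ∈ D, ∀ d₁' ∈ D, ∀ d₂' ∈ D,
      d₁ + d₂ = d₁' + d₂' → (d₁ = d₁' ∧ d₂ = d₂') ∨ (d₁ = d₂' ∧ d₂ = d₁'))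
    (hDirect : ∀ d₁ ∈ D, ∀ d₂ ∈ D, ∀ d₁' ∈ D, ∀ d₂' ∈ D, ∀ h₁ ∈ H, ∀ h₂ ∈ H, ∀ h₁' ∈ H, ∀ h₂' ∈ H,
      d₁ + d₂ + (h₁ + h₂) = d₁' + d₂' + (h₁' + h₂') → d₁ + d₂ = d₁' + d₂')
    (hNoWrap : ∀ d ∈ D, ∀ d' ∈ D, ∀ h ∈ H, ∀ h' ∈ H, d + d' + (h + h') < p)
    (hF : F.natDegree < p) (hdvd : (X : ℂ[X]) ^ p - 1 ∣ (α * U) * (β * V) - F)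
    (M : ℝ) (hM : ∀ n, ‖F.coeff n‖ ≤ M) :
    ∃ (s' : ℕ) (c' : Fin s' → ℂ) (w' : Fin s' → ℂ[X]),
      (∀ j, (w' j).support ⊆ (D ×ˢ H).image (fun q : ℕ × ℕ => q.1 + q.2)) ∧
      ((X : ℂ[X]) ^ p - 1 ∣ (∑ j, C (c' j) * w' j ^ 2) - F) ∧
      (∑ j, sqMass (c' j) (w' j)) ≤
        2 * (((H ×ˢ H).image (fun q : ℕ × ℕ => q.1 + q.2)).card : ℝ) * (D.card : ℝ) * M := by
  classical
  have hM0 : 0 ≤ M := (norm_nonneg _).trans (hM 0)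
  set S : Finset ℕ := (D ×ˢ H).image (fun q : ℕ × ℕ => q.1 + q.2) with hSdef
  set HH : Finset ℕ := (H ×ˢ H).image (fun q : ℕ × ℕ => q.1 + q.2) with hHHdef
  have hFeq : F = (α * β) * (U * V) := pattern_eq_mul p D H α β U V F hα hβ hU hV hNoWrap hF hdvd
  set G : ℂ[X] := U * V with hGdef
  -- the trivial case `F = 0`
  by_cases hF0 : F = 0
  · refine ⟨0, Fin.elim0, Fin.elim0, fun j => Fin.elim0 j, ?_, ?_⟩
    · rw [hF0]; simp
    · simp only [Finset.univ_eq_empty, Finset.sum_empty]; positivity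
  -- norms on `D`
  set A : ℝ := ∑ d ∈ D, ‖α.coeff d‖ ^ 2 with hAdef
  set B : ℝ := ∑ d ∈ D, ‖β.coeff d‖ ^ 2 with hBdef
  have hA0 : 0 ≤ A := Finset.sum_nonneg fun _ _ => sq_nonneg _
  have hB0 : 0 ≤ B := Finset.sum_nonneg fun _ _ => sq_nonneg _
  have vanish_of_zero : ∀ (φ : ℂ[X]), φ.support ⊆ D → (∑ d ∈ D, ‖φ.coeff d‖ ^ 2) = 0 → φ = 0 := by
    intro φ hφ h0
    ext n
    by_cases hn : n ∈ φ.support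
    · have := (Finset.sum_eq_zero_iff_of_nonneg (fun d _ => sq_nonneg ‖φ.coeff d‖)).1 h0 n (hφ hn)
      exact norm_eq_zero.1 ((pow_eq_zero_iff two_ne_zero).1 this)
    · exact notMem_support_iff.1 hn
  have hApos : 0 < A := by
    rcases hA0.lt_or_eq with h | h
    · exact h
    · exfalso; apply hF0
      rw [hFeq, vanish_of_zero α hα h.symm]; ring
  have hBpos : 0 < B := by
    rcases hB0.lt_or_eq with h | h
    · exact h
    · exfalso; apply hF0
      rw [hFeq, vanish_of_zero β hβ h.symm]; ring
  -- the key bound `|G_f| · √A · √B ≤ √2 · #D · M ≤ 2 #D M` for `f ∈ H + H`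
  have hkey : ∀ f : HH, ‖G.coeff f.1‖ * (Real.sqrt A * Real.sqrt B) ≤ 2 * (D.card : ℝ) * M := by
    intro f
    obtain ⟨q, hq, hqf⟩ := Finset.mem_image.1 f.2
    obtain ⟨hh, hh'⟩ := Finset.mem_product.1 hq
    have hE := tensor_energy_bound D H α β U V F hα hβ hU hV hSidon hDirect hFeq M hM hh hh'
    rw [hqf] at hE
    -- `(A B) g² ≤ 2 #D² M²` ⇒ `g √A √B ≤ √2 #D M ≤ 2 #D M`
    have hsq : (‖G.coeff f.1‖ * (Real.sqrt A * Real.sqrt B)) ^ 2 ≤ (2 * (D.card : ℝ) * M) ^ 2 := by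
      have e : (‖G.coeff f.1‖ * (Real.sqrt A * Real.sqrt B)) ^ 2 = A * B * ‖G.coeff f.1‖ ^ 2 := by
        rw [mul_pow, mul_pow, Real.sq_sqrt hA0, Real.sq_sqrt hB0]; ring
      rw [e]
      nlinarith [hE, sq_nonneg ((D.card : ℝ) * M)]
    exact (pow_le_pow_iff_left₀ (by positivity) (by positivity) two_ne_zero).1 hsq
  -- one representation per `f ∈ H+H` and a square root of `G_f`
  have hrep : ∀ f : HH, ∃ q : ℕ × ℕ, q ∈ H ×ˢ H ∧ q.1 + q.2 = f.1 := fun f => by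
    obtain ⟨q, hq, h⟩ := Finset.mem_image.1 f.2; exact ⟨q, hq, h⟩
  choose rep hrepH hrepf using hrep
  have hγ : ∀ f : HH, ∃ γ : ℂ, γ ^ 2 = G.coeff f.1 := fun f =>
    ⟨G.coeff f.1 ^ ((2 : ℂ)⁻¹), Complex.cpow_nat_inv_pow _ two_ne_zero⟩
  choose γ hγ using hγ
  -- the balance parameter `t² = √B/√A`
  set T : ℝ := Real.sqrt B / Real.sqrt A with hTdef
  have hTpos : 0 < T := div_pos (Real.sqrt_pos.2 hBpos) (Real.sqrt_pos.2 hApos)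
  have hsA : Real.sqrt A * Real.sqrt A = A := Real.mul_self_sqrt hA0
  have hsB : Real.sqrt B * Real.sqrt B = B := Real.mul_self_sqrt hB0
  have hsApos : 0 < Real.sqrt A := Real.sqrt_pos.2 hApos
  have hsBpos : 0 < Real.sqrt B := Real.sqrt_pos.2 hBpos
  have hTA : T * A = Real.sqrt A * Real.sqrt B := by
    rw [hTdef, div_mul_eq_mul_div, div_eq_iff hsApos.ne']
    linear_combination (-(Real.sqrt B)) * hsA
  have hBT : B / T = Real.sqrt A * Real.sqrt B := by
    rw [hTdef, div_div_eq_mul_div, div_eq_iff hsBpos.ne']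
    linear_combination (-(Real.sqrt A)) * hsB
  -- the products along `D`, shifted and weighted along `H`, and their two squares each
  have hsq : ∀ f : HH, ∃ (c' : Fin 2 → ℂ) (w' : Fin 2 → ℂ[X]), (∀ j, (w' j).support ⊆ S) ∧
      ((X : ℂ[X]) ^ p - 1 ∣ (∑ j, C (c' j) * w' j ^ 2) -
        (C (γ f) * X ^ (rep f).1 * α) * (C (γ f) * X ^ (rep f).2 * β)) ∧
      (∑ j, sqMass (c' j) (w' j)) ≤ ‖G.coeff f.1‖ * (Real.sqrt A * Real.sqrt B) := by
    intro f
    have hh : (rep f).1 ∈ H := (Finset.mem_product.1 (hrepH f)).1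
    have hh' : (rep f).2 ∈ H := (Finset.mem_product.1 (hrepH f)).2
    obtain ⟨c', w', h1, h2, h3⟩ := exists_squares_of_mul p S
      (C (γ f) * X ^ (rep f).1 * α) (C (γ f) * X ^ (rep f).2 * β)
      ((C (γ f) * X ^ (rep f).1 * α) * (C (γ f) * X ^ (rep f).2 * β))
      (support_shift_subset (γ f) hh α hα) (support_shift_subset (γ f) hh' β hβ)
      (by rw [sub_self]; exact dvd_zero _) (Real.sqrt T) (Real.sqrt_pos.2 hTpos)
    refine ⟨c', w', h1, h2, h3.trans ?_⟩
    -- the coefficient norms of the shifted weighted factors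
    have hγn : ‖γ f‖ ^ 2 = ‖G.coeff f.1‖ := by rw [← norm_pow, hγ f]
    have hcoefA : ∑ s ∈ S, ‖(C (γ f) * X ^ (rep f).1 * α).coeff s‖ ^ 2 = ‖G.coeff f.1‖ * A := by
      rw [hSdef, sum_normSq_shift (γ f) hh α hα, hγn]
    have hcoefB : ∑ s ∈ S, ‖(C (γ f) * X ^ (rep f).2 * β).coeff s‖ ^ 2 = ‖G.coeff f.1‖ * B := by
      rw [hSdef, sum_normSq_shift (γ f) hh' β hβ, hγn]
    rw [hcoefA, hcoefB, Real.sq_sqrt hTpos.le]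
    have e : (T * (‖G.coeff f.1‖ * A) + ‖G.coeff f.1‖ * B / T) / 2 =
        ‖G.coeff f.1‖ * ((T * A + B / T) / 2) := by ring
    rw [e, hTA, hBT]
    linarith
  choose cf wf hwS hwdvd hwmass using hsq
  -- `G` lives on `H + H`, and the products sum to `F`
  have hGsupp : G.support ⊆ HH := support_mul_subset_of fun i hi j hj =>
    Finset.mem_image.2 ⟨(i, j), Finset.mem_product.2 ⟨hU hi, hV hj⟩, rfl⟩
  have hGsum : G = ∑ f : HH, C (G.coeff f.1) * X ^ f.1 := by
    conv_lhs => rw [as_sum_support_C_mul_X_pow G]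
    rw [Finset.sum_subset hGsupp (fun f _ hf => by rw [notMem_support_iff.1 hf, map_zero, zero_mul])]
    exact (Finset.sum_coe_sort HH (fun f => C (G.coeff f) * X ^ f)).symm
  have hprod : ∀ f : HH, (C (γ f) * X ^ (rep f).1 * α) * (C (γ f) * X ^ (rep f).2 * β) =
      (C (G.coeff f.1) * X ^ f.1) * (α * β) := by
    intro f
    rw [← hγ f, map_pow, ← hrepf f, pow_add]; ring
  have hsumprod : (∑ f : HH, (C (γ f) * X ^ (rep f).1 * α) * (C (γ f) * X ^ (rep f).2 * β)) = F := by
    rw [Finset.sum_congr rfl fun f _ => hprod f, ← Finset.sum_mul, ← hGsum, hFeq, hGdef]; ring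
  -- the family, indexed by `HH × Fin 2`, reindexed by `Fin s'`
  let cc : HH × Fin 2 → ℂ := fun q => cf q.1 q.2
  let ww : HH × Fin 2 → ℂ[X] := fun q => wf q.1 q.2
  let e := (Fintype.equivFin (HH × Fin 2)).symm
  refine ⟨Fintype.card (HH × Fin 2), fun j => cc (e j), fun j => ww (e j), fun j => hwS _ _, ?_, ?_⟩
  · rw [Fintype.sum_equiv e (fun j => C (cc (e j)) * ww (e j) ^ 2) (fun q => C (cc q) * ww q ^ 2)
      (fun j => rfl), Fintype.sum_prod_type]
    have h1 : (X : ℂ[X]) ^ p - 1 ∣ (∑ f : HH, ∑ i : Fin 2, C (cc (f, i)) * ww (f, i) ^ 2) -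
        ∑ f : HH, (C (γ f) * X ^ (rep f).1 * α) * (C (γ f) * X ^ (rep f).2 * β) := by
      rw [← Finset.sum_sub_distrib]
      exact Finset.dvd_sum fun f _ => hwdvd f
    rwa [hsumprod] at h1
  · rw [Fintype.sum_equiv e (fun j => sqMass (cc (e j)) (ww (e j))) (fun q => sqMass (cc q) (ww q))
      (fun j => rfl), Fintype.sum_prod_type]
    calc ∑ f : HH, ∑ i : Fin 2, sqMass (cc (f, i)) (ww (f, i))
        ≤ ∑ f : HH, ‖G.coeff f.1‖ * (Real.sqrt A * Real.sqrt B) := Finset.sum_le_sum fun f _ => hwmass f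
      _ ≤ ∑ f : HH, 2 * (D.card : ℝ) * M := Finset.sum_le_sum fun f _ => hkey f
      _ = 2 * (HH.card : ℝ) * (D.card : ℝ) * M := by
          rw [Finset.sum_const, Finset.card_univ, Fintype.card_coe, nsmul_eq_mul]; ring

end TensorTame

end

end Summit.ValiantsHypothesis.ValiantsHypothesis.Theorems.FeketeSOSHardPaleyRIP
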